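import Literature.NumberTheory.Automorphic.UnitaryGroupTruncatedTraceClassUnipotentUnfold
import Literature.NumberTheory.Automorphic.UnitaryGroupTruncatedKernelClassIntegrableOfCusp
import Literature.NumberTheory.Automorphic.UnitaryGroupKernelOffBorelVanishing
import Literature.NumberTheory.Automorphic.UnitaryGroupMahlerRegion
import Literature.NumberTheory.Automorphic.UnitaryGroupTruncatedTraceClassElliptic
import HarnessLib

/-!
# The unfolded bracket of the unipotent term is absolutely integrable:
# `∫⁻_{G(𝔸)} β(g) ‖Σ_{u ∈ N(F), u ≠ 1} f(g⁻¹ z₁ u g) − 1_{H(g) > T} K_{B,𝔬}(g, g)‖ dν_G(g) < ∞`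
(Rogawski, *Automorphic Representations of Unitary Groups in Three Variables* (1990), §7.3 pp. 95–96:
«these two terms are separately integrable» for the class `𝔬 = z·𝒰`; Arthur, *A trace formula for reductive
groups I*, Duke Math. J. 45 (1978), Thm. 7.1 / §8; Gelbart (1975), §9.B (9.40)–(9.46) for the unfolding)

Topic `NumberTheory/Automorphic`; namespace `Literature.NumberTheory.Automorphic.UnitaryGroup`. THEOREMS ONLY
over accepted tree modules (no definition, no named fact, no instance, no notation, no `sorry`). Row (L5-i)
(HINT) of the T1-qs LAW 5 road of `Cruxes/H413/Lines/F0_T1InnerFormTraceIdentity.lean` (cell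
`pub/hodgecm-mathlib`, crux H413): the ONE analytic input `hint` of ★ B1
`truncatedTraceClass_central_eq_add_mul_integral` (`UnitaryGroupTruncatedTraceClassUnipotentUnfold`), token for
token. Letters as there: `ζ ∈ E¹`, `z₁ ∈ G(F)` with `↑z₁ = ι(ratCenter ζ)`, the class `𝔬 = cl⁻¹{i}` of
characteristic polynomial `(X − z)³`, `ν` a Haar measure of `N(𝔸_F)`, `𝓕` a fundamental domain of `N(F)`, an
automorphic measure `μ`, an inversion-invariant Haar measure `ν_G`, a covering weight `β` of `B(F)♯`, and the
BRACKET `ψ_T(y) := Σ'_{u ∈ N(F), u ≠ 1} f(y⁻¹ z₁ u y) − 1_{T < H(y)} K_{B,𝔬}(y,y)` spelled INLINE.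

THE ARGUMENT (no pointwise cancellation is needed). Put `Θ := ‖ψ_T‖ₑ` (Borel ★ `measurable_bracket`,
left-`B(F)`-invariant ★ `bracket_rational_borel_mul`). The coset-sum unfolding ★
`exists_ne_zero_lintegral_tsum_borelQuotient_eq_mul_lintegral` (L2-u, `[0,∞]`, valid for EVERY `Θ ≥ 0`) gives
`C · ∫⁻_G β Θ dν_G = ∫⁻_X Σ'_{q ∈ B(F)\G(F)} Θ(q̃ x̃⁻¹) dμ` with `0 < C < ∞`, so it suffices to bound the coset sum
`Φ(y) := Σ'_q ‖ψ_T(q̃ y)‖ₑ` pointwise by an integrable function on `X`. DICHOTOMY at `y` (the pattern of ★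
`enorm_truncatedKernelClass_le_of_dichotomy`), for `T ≥ 1` and `T ≥ c₁(f)` (★
`exists_forall_apply_conj_eq_zero_of_not_mem_arithmeticBorel`: conjugates `g⁻¹ γ g` by `γ ∉ B(F)` miss `supp f`
once `H(g) > c₁`):
(A) some translate has `T < H(γ₀ y)`: there is ONE live coset `q₀` (★ `borelHeight_mul_lt_one_of_not_mem_arithmeticBorel`);
for `q ≠ q₀`, `q̃ y = δ (q̃₀ y)` with `δ ∉ B(F)` has no tail and every `u ≠ 1` term is `f(z⁻¹ (δ⁻¹ z₁ u δ) z)`,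
`z := q̃₀ y`, with `δ⁻¹ z₁ u δ ∉ B(F)` (★ `mem_arithmeticBorel_of_conj_mem_of_conj_mem`) — zero. Hence
`Φ(y) = ‖ψ_T(q̃₀ y)‖ₑ = ‖k^T_𝔬(y) − f(z₁)‖ₑ` by ★ `truncatedKernelClass_eq_add_tsum_bracket`.
(B) no translate is above `T`: there are no tails and `Φ(y) ≤ Σ'_{γ ∈ G(F)} ‖f(y⁻¹ γ y)‖ ≤ Cb`, the bound of the
kernel of `|f|` on the Mahler region of level `T⁻¹` (★ `exists_forall_norm_kernel_le`, ★ `norm_kernel_ofReal_norm`,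
★ `forall_inv_le_vecHeight_of_forall_borelHeight_le`), via the injection `(q,u) ↦ q̃⁻¹ z₁ u q̃` (★
`exists_equiv_borelQuotient_prod_central`).
So `Φ(y) ≤ ‖k^T_𝔬(y)‖ₑ + ‖f(z₁)‖ₑ + Cb`, and `∫⁻_X Φ(x̃⁻¹) dμ < ∞` from `Integrable (quotFun k^T_𝔬) μ` (★ LAW 3).

* §1 `conj_not_mem_arithmeticBorel_of_not_mem` · `bracket_eq_zero_of_not_mem_arithmeticBorel` (case-A vanishing).
* §2 `tsum_enorm_bracket_translate_eq_of_lt` (case A) · `tsum_enorm_bracket_translate_le_of_forall_le` (case B)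
  · **`tsum_enorm_bracket_translate_le`** (the pointwise bound).
* §3 **`lintegral_weight_mul_enorm_bracket_lt_top`** — (HINT) with B1's binders, given
  `Integrable (quotFun (truncatedKernelClass ν 𝓕 T cl i f)) μ`, `1 ≤ T`, `c₁(f) ≤ T`;
  **`exists_forall_lintegral_weight_mul_enorm_bracket_lt_top`** — `∃ T₀, ∀ T > T₀, Integrable (quotFun k^T_𝔬) μ →
  ∫⁻ β ‖ψ_T‖ₑ < ∞`.

## References
* J. D. Rogawski, *Automorphic Representations of Unitary Groups in Three Variables*, Ann. of Math. Stud. 123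
  (1990), §7.3 pp. 95–96; §2.2 p. 13 [Rogawski1990].
* J. Arthur, *A trace formula for reductive groups I*, Duke Math. J. 45 (1978), Thm. 7.1, §8 [Arthur1978TraceFormulaI].
* S. Gelbart, *Automorphic forms on adele groups*, Ann. of Math. Stud. 83 (1975), §9.B (9.40)–(9.46) [Gelbart1975].
-/

set_option autoImplicit false

noncomputable section

open MeasureTheory Measure NumberField IsDedekindDomain Set Filter Polynomial Matrix Literature.MeasureTheory.Group
open scoped NNReal ENNReal Pointwise

namespace Literature.NumberTheory.Automorphic

namespace UnitaryGroup

variable {F E : Type} [Field F] [NumberField F] [Field E] [NumberField E] [Algebra F E]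
  {c : E ≃ₐ[F] E} {ι : Type*}

variable (ζ : ratOne F E c) {z₁ : (quasiSplit F E c 3).arithmeticSubgroup}

/-! ## §1 Conjugates of `z₁ u` off the Borel, and the vanishing of the off-coset brackets -/

section OffBorel

/-- **`δ⁻¹ (z₁ u) δ ∉ B(F)` for `δ ∉ B(F)` and `u ∈ N(F)`, `u ≠ 1`**: the rational Borel containing a
non-central element of the class `z·𝒰` is unique (★ `mem_arithmeticBorel_of_conj_mem_of_conj_mem`; `z₁ u ∈ B(F)`,
and `z₁ u` is not the scalar `z` since `u ≠ 1`, ★ `eq_of_coe_adelicVal_eq_smul_one`).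
[cite: Rogawski1990, Prop. 7.2.1 (pp. 91–92)] -/
theorem conj_not_mem_arithmeticBorel_of_not_mem
    (hz₁ : (z₁ : (quasiSplit F E c 3).Adelic) =
      (quasiSplit F E c 3).toAdelic (ratCenter F E c 3 ((StdForm.antidiagonal 3).over E) ζ))
    {δ : (quasiSplit F E c 3).arithmeticSubgroup} (hδ : δ ∉ arithmeticBorel F E c 3)
    (u : {u : rationalUnipotent F E c 3 // u ≠ 1}) :
    δ⁻¹ * (z₁ * ⟨(((u.1 : rationalUnipotent F E c 3) : adelicUnipotent F E c 3) : (quasiSplit F E c 3).Adelic),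
        (u.1 : rationalUnipotent F E c 3).2⟩) * δ ∉ arithmeticBorel F E c 3 := by
  set uG : (quasiSplit F E c 3).arithmeticSubgroup :=
    ⟨(((u.1 : rationalUnipotent F E c 3) : adelicUnipotent F E c 3) : (quasiSplit F E c 3).Adelic),
      (u.1 : rationalUnipotent F E c 3).2⟩ with huG
  have huN : ((uG : (quasiSplit F E c 3).arithmeticSubgroup) : (quasiSplit F E c 3).Adelic) ∈ adelicUnipotent F E c 3 :=
    ((u.1 : rationalUnipotent F E c 3) : adelicUnipotent F E c 3).2
  intro h
  -- `z₁ u ∈ B(F)`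
  have h₁ : (1 : (quasiSplit F E c 3).arithmeticSubgroup) * (z₁ * uG) * 1⁻¹ ∈ arithmeticBorel F E c 3 := by
    rw [one_mul, inv_one, mul_one]
    refine Subgroup.mul_mem _ (mem_arithmeticBorel_of_coe_eq_toAdelic_ratCenter ζ hz₁) ?_
    rw [mem_arithmeticBorel_iff]
    exact adelicUnipotent_le_borelAdelic huN
  have h₂ : δ⁻¹ * (z₁ * uG) * δ⁻¹⁻¹ ∈ arithmeticBorel F E c 3 := by rw [inv_inv]; exact h
  -- `z₁ u` is not the scalar matrix `z`
  have hne : ((adelicVal F E c 3 _ ((z₁ * uG : (quasiSplit F E c 3).arithmeticSubgroup) :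
      (quasiSplit F E c 3).Adelic) : GL (Fin 3) (AdeleRing (𝓞 E) E)) : Matrix (Fin 3) (Fin 3) (AdeleRing (𝓞 E) E)) ≠
      algebraMap E (AdeleRing (𝓞 E) E) ((ζ : Eˣ) : E) • (1 : Matrix (Fin 3) (Fin 3) (AdeleRing (𝓞 E) E)) := by
    intro heq
    have hzu : z₁ * uG = z₁ := eq_of_coe_adelicVal_eq_smul_one ζ hz₁ heq
    have hu1 : uG = 1 := mul_left_cancel (a := z₁) (by rw [hzu, mul_one])
    apply u.2
    have : (((u.1 : rationalUnipotent F E c 3) : adelicUnipotent F E c 3) : (quasiSplit F E c 3).Adelic) = 1 :=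
      congrArg (fun γ : (quasiSplit F E c 3).arithmeticSubgroup => (γ : (quasiSplit F E c 3).Adelic)) hu1
    exact Subtype.ext (Subtype.ext this)
  have key := mem_arithmeticBorel_of_conj_mem_of_conj_mem (conj_mul_self_of_ratOne ζ)
    (charpoly_mul_eq_of_mem_adelicUnipotent ζ hz₁ huN) hne h₁ h₂
  rw [inv_one, mul_one] at key
  exact hδ (by simpa using Subgroup.inv_mem _ key)

variable [MeasurableSpace (adelicUnipotent F E c 3)]

/-- **The bracket vanishes off the live coset.** If conjugates by elements off `B(F)` miss the support of `f`
above height `c₁` (`hc₁`, ★ `exists_forall_apply_conj_eq_zero_of_not_mem_arithmeticBorel`), then for `δ ∉ B(F)`,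
`z` with `c₁ < H(z)` and `H(δ z) ≤ T`:  `ψ_T(δ z) = 0` — no tail below the cut-off, and each term
`f((δz)⁻¹ z₁ u (δz)) = f(z⁻¹ (δ⁻¹ z₁ u δ) z)` vanishes by §1. [cite: Rogawski1990, §7.3 (p. 95)] -/
theorem bracket_eq_zero_of_not_mem_arithmeticBorel {cl : (quasiSplit F E c 3).arithmeticSubgroup → ι}
    (hz₁ : (z₁ : (quasiSplit F E c 3).Adelic) =
      (quasiSplit F E c 3).toAdelic (ratCenter F E c 3 ((StdForm.antidiagonal 3).over E) ζ))
    (ν : Measure (adelicUnipotent F E c 3)) (𝓕 : Set (adelicUnipotent F E c 3)) {T : ℝ≥0} (i : ι)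
    {f : (quasiSplit F E c 3).Adelic → ℂ} {c₁ : ℝ≥0}
    (hc₁ : ∀ g : (quasiSplit F E c 3).Adelic, c₁ < borelHeight g →
      ∀ γ : (quasiSplit F E c 3).arithmeticSubgroup, γ ∉ arithmeticBorel F E c 3 →
        f (g⁻¹ * (γ : (quasiSplit F E c 3).Adelic) * g) = 0)
    {δ : (quasiSplit F E c 3).arithmeticSubgroup} (hδ : δ ∉ arithmeticBorel F E c 3)
    {z : (quasiSplit F E c 3).Adelic} (hz : c₁ < borelHeight z)
    (hle : ¬ T < borelHeight ((δ : (quasiSplit F E c 3).Adelic) * z)) :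
    (∑' u : {u : rationalUnipotent F E c 3 // u ≠ 1},
      f (((δ : (quasiSplit F E c 3).Adelic) * z)⁻¹ *
        ((z₁ * ⟨(((u.1 : rationalUnipotent F E c 3) : adelicUnipotent F E c 3) : (quasiSplit F E c 3).Adelic),
          (u.1 : rationalUnipotent F E c 3).2⟩ : (quasiSplit F E c 3).arithmeticSubgroup) :
            (quasiSplit F E c 3).Adelic) * ((δ : (quasiSplit F E c 3).Adelic) * z))) -
      kernelBorelTailClass ν 𝓕 T cl i f ((δ : (quasiSplit F E c 3).Adelic) * z) = 0 := by
  rw [kernelBorelTailClass_of_not_lt cl i f hle, sub_zero]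
  have h0 : ∀ u : {u : rationalUnipotent F E c 3 // u ≠ 1},
      f (((δ : (quasiSplit F E c 3).Adelic) * z)⁻¹ *
        ((z₁ * ⟨(((u.1 : rationalUnipotent F E c 3) : adelicUnipotent F E c 3) : (quasiSplit F E c 3).Adelic),
          (u.1 : rationalUnipotent F E c 3).2⟩ : (quasiSplit F E c 3).arithmeticSubgroup) :
            (quasiSplit F E c 3).Adelic) * ((δ : (quasiSplit F E c 3).Adelic) * z)) = 0 := fun u => by
    have hconj : ((δ : (quasiSplit F E c 3).Adelic) * z)⁻¹ *
        ((z₁ * ⟨(((u.1 : rationalUnipotent F E c 3) : adelicUnipotent F E c 3) : (quasiSplit F E c 3).Adelic),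
          (u.1 : rationalUnipotent F E c 3).2⟩ : (quasiSplit F E c 3).arithmeticSubgroup) :
            (quasiSplit F E c 3).Adelic) * ((δ : (quasiSplit F E c 3).Adelic) * z) =
        z⁻¹ * (((δ⁻¹ * (z₁ * ⟨(((u.1 : rationalUnipotent F E c 3) : adelicUnipotent F E c 3) :
          (quasiSplit F E c 3).Adelic), (u.1 : rationalUnipotent F E c 3).2⟩) * δ :
            (quasiSplit F E c 3).arithmeticSubgroup)) : (quasiSplit F E c 3).Adelic) * z := by
      simp only [Subgroup.coe_mul, Subgroup.coe_inv, _root_.mul_inv_rev, mul_assoc]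
    rw [hconj]
    exact hc₁ z hz _ (conj_not_mem_arithmeticBorel_of_not_mem ζ hz₁ hδ u)
  simp only [h0, tsum_zero]

end OffBorel

/-! ## §2 The pointwise bound on the coset sum of `‖ψ_T‖` -/

section Pointwise

variable [MeasurableSpace (adelicUnipotent F E c 3)]

/-- **CASE A (one live coset).** If some translate of `y` lies above the cut-off `T ≥ max(1, c₁)`, the coset sum of
`‖ψ_T‖` at `y` has exactly one non-zero term and equals `‖k^T_𝔬(y) − f(z₁)‖` (★
`truncatedKernelClass_eq_add_tsum_bracket`; the other cosets are `δ (q̃₀ y)` with `δ ∉ B(F)`, below height `1`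
by ★ `borelHeight_mul_lt_one_of_not_mem_arithmeticBorel`, where §1 kills the bracket).
[cite: Rogawski1990, §7.3 (pp. 95–96)] [cite: Rogawski1990, §2.2 (p. 13)] -/
theorem tsum_enorm_bracket_translate_eq_of_lt {cl : (quasiSplit F E c 3).arithmeticSubgroup → ι}
    (hc : c * c = 1) (hz₁ : (z₁ : (quasiSplit F E c 3).Adelic) =
      (quasiSplit F E c 3).toAdelic (ratCenter F E c 3 ((StdForm.antidiagonal 3).over E) ζ))
    {i : ι} (hcl : ∀ γ : (quasiSplit F E c 3).arithmeticSubgroup, cl γ = i ↔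
      ((adelicVal F E c 3 _ (γ : (quasiSplit F E c 3).Adelic) : GL (Fin 3) (AdeleRing (𝓞 E) E)) :
          Matrix (Fin 3) (Fin 3) (AdeleRing (𝓞 E) E)).charpoly =
        ((X - C ((ζ : Eˣ) : E)) ^ 3).map (algebraMap E (AdeleRing (𝓞 E) E)))
    (ν : Measure (adelicUnipotent F E c 3)) (𝓕 : Set (adelicUnipotent F E c 3)) {T : ℝ≥0} (hT : 1 ≤ T)
    {f : (quasiSplit F E c 3).Adelic → ℂ} {c₁ : ℝ≥0}
    (hc₁ : ∀ g : (quasiSplit F E c 3).Adelic, c₁ < borelHeight g →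
      ∀ γ : (quasiSplit F E c 3).arithmeticSubgroup, γ ∉ arithmeticBorel F E c 3 →
        f (g⁻¹ * (γ : (quasiSplit F E c 3).Adelic) * g) = 0)
    (hTc : c₁ ≤ T) (y : (quasiSplit F E c 3).Adelic)
    (hsum : Summable fun γ : cl ⁻¹' {i} =>
      f (y⁻¹ * (((γ : cl ⁻¹' {i}) : (quasiSplit F E c 3).arithmeticSubgroup) : (quasiSplit F E c 3).Adelic) * y))
    {γ₀ : (quasiSplit F E c 3).arithmeticSubgroup} (hγ₀ : T < borelHeight ((γ₀ : (quasiSplit F E c 3).Adelic) * y)) :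
    ∑' q : Quotient (QuotientGroup.rightRel (arithmeticBorel F E c 3)),
        ‖((∑' u : {u : rationalUnipotent F E c 3 // u ≠ 1},
          f ((((q.out : (quasiSplit F E c 3).arithmeticSubgroup) : (quasiSplit F E c 3).Adelic) * y)⁻¹ * ((z₁ * ⟨(((u.1 : rationalUnipotent F E c 3) : adelicUnipotent F E c 3) : (quasiSplit F E c 3).Adelic), (u.1 : rationalUnipotent F E c 3).2⟩ : (quasiSplit F E c 3).arithmeticSubgroup) : (quasiSplit F E c 3).Adelic) * (((q.out : (quasiSplit F E c 3).arithmeticSubgroup) : (quasiSplit F E c 3).Adelic) * y))) -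
        kernelBorelTailClass ν 𝓕 T cl i f (((q.out : (quasiSplit F E c 3).arithmeticSubgroup) : (quasiSplit F E c 3).Adelic) * y))‖ₑ =
      ‖truncatedKernelClass ν 𝓕 T cl i f y - f (z₁ : (quasiSplit F E c 3).Adelic)‖ₑ := by
  classical
  have hT0 : 0 < T := lt_of_lt_of_le one_pos hT
  have hT1 : 1 < borelHeight ((γ₀ : (quasiSplit F E c 3).Adelic) * y) := lt_of_le_of_lt hT hγ₀
  set q₀ : Quotient (QuotientGroup.rightRel (arithmeticBorel F E c 3)) := Quotient.mk _ γ₀ with hq₀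
  -- for `q ≠ q₀`, `δ := q̃ γ₀⁻¹ ∉ B(F)` and `q̃ y = δ (γ₀ y)`
  have hδ : ∀ q : Quotient (QuotientGroup.rightRel (arithmeticBorel F E c 3)), q ≠ q₀ →
      q.out * γ₀⁻¹ ∉ arithmeticBorel F E c 3 := by
    intro q hq hδB
    apply hq
    rw [hq₀, ← Quotient.out_eq q]
    exact Quotient.sound (QuotientGroup.rightRel_apply.2 (by
      rw [show γ₀ * (q.out : (quasiSplit F E c 3).arithmeticSubgroup)⁻¹ = (q.out * γ₀⁻¹)⁻¹ by
        rw [_root_.mul_inv_rev, inv_inv]]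
      exact inv_mem hδB))
  have hqy : ∀ q : Quotient (QuotientGroup.rightRel (arithmeticBorel F E c 3)),
      ((q.out : (quasiSplit F E c 3).arithmeticSubgroup) : (quasiSplit F E c 3).Adelic) * y =
        (((q.out * γ₀⁻¹ : (quasiSplit F E c 3).arithmeticSubgroup)) : (quasiSplit F E c 3).Adelic) *
          (((γ₀ : (quasiSplit F E c 3).Adelic)) * y) := by
    intro q
    rw [Subgroup.coe_mul, Subgroup.coe_inv]; group
  have hzero : ∀ q : Quotient (QuotientGroup.rightRel (arithmeticBorel F E c 3)), q ≠ q₀ →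
      ((∑' u : {u : rationalUnipotent F E c 3 // u ≠ 1},
          f ((((q.out : (quasiSplit F E c 3).arithmeticSubgroup) : (quasiSplit F E c 3).Adelic) * y)⁻¹ * ((z₁ * ⟨(((u.1 : rationalUnipotent F E c 3) : adelicUnipotent F E c 3) : (quasiSplit F E c 3).Adelic), (u.1 : rationalUnipotent F E c 3).2⟩ : (quasiSplit F E c 3).arithmeticSubgroup) : (quasiSplit F E c 3).Adelic) * (((q.out : (quasiSplit F E c 3).arithmeticSubgroup) : (quasiSplit F E c 3).Adelic) * y))) -
        kernelBorelTailClass ν 𝓕 T cl i f (((q.out : (quasiSplit F E c 3).arithmeticSubgroup) : (quasiSplit F E c 3).Adelic) * y)) = 0 := by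
    intro q hq
    rw [hqy q]
    refine bracket_eq_zero_of_not_mem_arithmeticBorel ζ hz₁ ν 𝓕 i hc₁ (hδ q hq) (lt_of_le_of_lt hTc hγ₀) ?_
    exact not_lt.2 ((borelHeight_mul_lt_one_of_not_mem_arithmeticBorel (hδ q hq) hT1).le.trans hT)
  rw [tsum_eq_single q₀ (fun q hq => by rw [hzero q hq, enorm_zero])]
  -- the `ℂ`-identity of ★ B1 with the same single live coset
  have hk := truncatedKernelClass_eq_add_tsum_bracket ζ hc hz₁ hcl ν 𝓕 hT0 f y hsum
  rw [tsum_eq_single q₀ (fun q hq => hzero q hq)] at hk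
  rw [hk, add_sub_cancel_left]

/-- **CASE B (no translate above the cut-off).** If `H(γ y) ≤ T` for every `γ ∈ G(F)`, no tail is present and the
coset sum of `‖ψ_T‖` at `y` is at most `Σ'_{γ ∈ G(F)} ‖f(y⁻¹ γ y)‖` (the injection `(q, u) ↦ q̃⁻¹ z₁ u q̃`, ★
`exists_equiv_borelQuotient_prod_central`), hence at most any bound `Cb` of that sum (the Mahler bound).
[cite: Rogawski1990, §7.3 (pp. 95–96)] [cite: Rogawski1990, §2.2 (p. 13)] -/
theorem tsum_enorm_bracket_translate_le_of_forall_le {cl : (quasiSplit F E c 3).arithmeticSubgroup → ι}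
    (hc : c * c = 1) (hz₁ : (z₁ : (quasiSplit F E c 3).Adelic) =
      (quasiSplit F E c 3).toAdelic (ratCenter F E c 3 ((StdForm.antidiagonal 3).over E) ζ))
    {i : ι} (hcl : ∀ γ : (quasiSplit F E c 3).arithmeticSubgroup, cl γ = i ↔
      ((adelicVal F E c 3 _ (γ : (quasiSplit F E c 3).Adelic) : GL (Fin 3) (AdeleRing (𝓞 E) E)) :
          Matrix (Fin 3) (Fin 3) (AdeleRing (𝓞 E) E)).charpoly =
        ((X - C ((ζ : Eˣ) : E)) ^ 3).map (algebraMap E (AdeleRing (𝓞 E) E)))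
    (ν : Measure (adelicUnipotent F E c 3)) (𝓕 : Set (adelicUnipotent F E c 3)) (T : ℝ≥0) {f : (quasiSplit F E c 3).Adelic → ℂ}
    (hf : HasCompactSupport f) (y : (quasiSplit F E c 3).Adelic)
    (hle : ∀ γ : (quasiSplit F E c 3).arithmeticSubgroup, borelHeight ((γ : (quasiSplit F E c 3).Adelic) * y) ≤ T)
    {Cb : ℝ} (hCb : ∑' γ : (quasiSplit F E c 3).arithmeticSubgroup, ‖f (y⁻¹ * (γ : (quasiSplit F E c 3).Adelic) * y)‖ ≤ Cb) :
    ∑' q : Quotient (QuotientGroup.rightRel (arithmeticBorel F E c 3)),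
        ‖((∑' u : {u : rationalUnipotent F E c 3 // u ≠ 1},
          f ((((q.out : (quasiSplit F E c 3).arithmeticSubgroup) : (quasiSplit F E c 3).Adelic) * y)⁻¹ * ((z₁ * ⟨(((u.1 : rationalUnipotent F E c 3) : adelicUnipotent F E c 3) : (quasiSplit F E c 3).Adelic), (u.1 : rationalUnipotent F E c 3).2⟩ : (quasiSplit F E c 3).arithmeticSubgroup) : (quasiSplit F E c 3).Adelic) * (((q.out : (quasiSplit F E c 3).arithmeticSubgroup) : (quasiSplit F E c 3).Adelic) * y))) -
        kernelBorelTailClass ν 𝓕 T cl i f (((q.out : (quasiSplit F E c 3).arithmeticSubgroup) : (quasiSplit F E c 3).Adelic) * y))‖ₑ ≤ ENNReal.ofReal Cb := by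
  classical
  obtain ⟨e, he⟩ := exists_equiv_borelQuotient_prod_central ζ hc hz₁ hcl
  -- no tails
  have htail : ∀ q : Quotient (QuotientGroup.rightRel (arithmeticBorel F E c 3)),
      kernelBorelTailClass ν 𝓕 T cl i f (((q.out : (quasiSplit F E c 3).arithmeticSubgroup) : (quasiSplit F E c 3).Adelic) * y) = 0 := fun q =>
    kernelBorelTailClass_of_not_lt cl i f (not_lt.2 (hle q.out))
  simp only [htail, sub_zero]
  -- the conjugation identity `(q̃y)⁻¹ (z₁ u) (q̃y) = y⁻¹ (q̃⁻¹ z₁ u q̃) y`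
  have hconj : ∀ (q : Quotient (QuotientGroup.rightRel (arithmeticBorel F E c 3)))
      (u : {u : rationalUnipotent F E c 3 // u ≠ 1}),
      (((q.out : (quasiSplit F E c 3).arithmeticSubgroup) : (quasiSplit F E c 3).Adelic) * y)⁻¹ * ((z₁ * ⟨(((u.1 : rationalUnipotent F E c 3) : adelicUnipotent F E c 3) : (quasiSplit F E c 3).Adelic), (u.1 : rationalUnipotent F E c 3).2⟩ : (quasiSplit F E c 3).arithmeticSubgroup) : (quasiSplit F E c 3).Adelic) * (((q.out : (quasiSplit F E c 3).arithmeticSubgroup) : (quasiSplit F E c 3).Adelic) * y) =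
        y⁻¹ * (((q.out⁻¹ * (z₁ * ⟨(((u.1 : rationalUnipotent F E c 3) : adelicUnipotent F E c 3) : (quasiSplit F E c 3).Adelic), (u.1 : rationalUnipotent F E c 3).2⟩) * q.out : (quasiSplit F E c 3).arithmeticSubgroup)) : (quasiSplit F E c 3).Adelic) * y := by
    intro q u
    simp only [Subgroup.coe_mul, Subgroup.coe_inv, _root_.mul_inv_rev, mul_assoc]
  -- `G(γ) := ‖f(y⁻¹ γ y)‖ₑ` on `G(F)` and its sum
  have hsumm : Summable fun γ : (quasiSplit F E c 3).arithmeticSubgroup =>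
      ‖f (y⁻¹ * (γ : (quasiSplit F E c 3).Adelic) * y)‖ := (summable_kernel_of_hasCompactSupport hf y y).norm
  have htot : (∑' γ : (quasiSplit F E c 3).arithmeticSubgroup, ‖f (y⁻¹ * (γ : (quasiSplit F E c 3).Adelic) * y)‖ₑ) ≤
      ENNReal.ofReal Cb := by
    have h1 : (∑' γ : (quasiSplit F E c 3).arithmeticSubgroup, ‖f (y⁻¹ * (γ : (quasiSplit F E c 3).Adelic) * y)‖ₑ) =
        ENNReal.ofReal (∑' γ : (quasiSplit F E c 3).arithmeticSubgroup, ‖f (y⁻¹ * (γ : (quasiSplit F E c 3).Adelic) * y)‖) := by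
      rw [ENNReal.ofReal_tsum_of_nonneg (fun _ => norm_nonneg _) hsumm]
      exact tsum_congr fun γ => (ofReal_norm _).symm
    rw [h1]
    exact ENNReal.ofReal_le_ofReal hCb
  refine le_trans ?_ htot
  -- `Σ'_q ‖Σ'_u‖ ≤ Σ'_q Σ'_u ‖·‖ = Σ'_(q,u) ≤ Σ'_γ`
  calc (∑' q : Quotient (QuotientGroup.rightRel (arithmeticBorel F E c 3)),
        ‖∑' u : {u : rationalUnipotent F E c 3 // u ≠ 1},
          f ((((q.out : (quasiSplit F E c 3).arithmeticSubgroup) : (quasiSplit F E c 3).Adelic) * y)⁻¹ * ((z₁ * ⟨(((u.1 : rationalUnipotent F E c 3) : adelicUnipotent F E c 3) : (quasiSplit F E c 3).Adelic), (u.1 : rationalUnipotent F E c 3).2⟩ : (quasiSplit F E c 3).arithmeticSubgroup) : (quasiSplit F E c 3).Adelic) *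
            (((q.out : (quasiSplit F E c 3).arithmeticSubgroup) : (quasiSplit F E c 3).Adelic) * y))‖ₑ)
      ≤ ∑' q : Quotient (QuotientGroup.rightRel (arithmeticBorel F E c 3)),
          ∑' u : {u : rationalUnipotent F E c 3 // u ≠ 1},
            ‖f (y⁻¹ * (((q.out⁻¹ * (z₁ * ⟨(((u.1 : rationalUnipotent F E c 3) : adelicUnipotent F E c 3) : (quasiSplit F E c 3).Adelic), (u.1 : rationalUnipotent F E c 3).2⟩) * q.out : (quasiSplit F E c 3).arithmeticSubgroup)) :
              (quasiSplit F E c 3).Adelic) * y)‖ₑ := by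
        refine ENNReal.tsum_le_tsum fun q => ?_
        refine (enorm_tsum_le_tsum_enorm).trans (le_of_eq (tsum_congr fun u => ?_))
        rw [hconj q u]
    _ = ∑' p : Quotient (QuotientGroup.rightRel (arithmeticBorel F E c 3)) × {u : rationalUnipotent F E c 3 // u ≠ 1},
          ‖f (y⁻¹ * (((p.1.out⁻¹ * (z₁ * ⟨(((p.2.1 : rationalUnipotent F E c 3) : adelicUnipotent F E c 3) :
            (quasiSplit F E c 3).Adelic), (p.2.1 : rationalUnipotent F E c 3).2⟩) * p.1.out :
              (quasiSplit F E c 3).arithmeticSubgroup)) : (quasiSplit F E c 3).Adelic) * y)‖ₑ :=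
        (ENNReal.tsum_prod).symm
    _ = ∑' s : {γ : ↥(cl ⁻¹' {i}) // ((γ : ↥(cl ⁻¹' {i})) : (quasiSplit F E c 3).arithmeticSubgroup) ≠ z₁},
          ‖f (y⁻¹ * ((((s : ↥(cl ⁻¹' {i})) : (quasiSplit F E c 3).arithmeticSubgroup) : (quasiSplit F E c 3).Adelic)) * y)‖ₑ := by
        rw [← e.tsum_eq]
        exact tsum_congr fun p => by rw [he p]
    _ ≤ ∑' γ : (quasiSplit F E c 3).arithmeticSubgroup, ‖f (y⁻¹ * (γ : (quasiSplit F E c 3).Adelic) * y)‖ₑ := by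
        have hinj : Function.Injective
            (fun s : {γ : ↥(cl ⁻¹' {i}) // ((γ : ↥(cl ⁻¹' {i})) : (quasiSplit F E c 3).arithmeticSubgroup) ≠ z₁} =>
              ((s : ↥(cl ⁻¹' {i})) : (quasiSplit F E c 3).arithmeticSubgroup)) := fun s₁ s₂ h =>
          Subtype.ext (Subtype.ext h)
        exact ENNReal.tsum_comp_le_tsum_of_injective hinj
          (fun γ : (quasiSplit F E c 3).arithmeticSubgroup => ‖f (y⁻¹ * (γ : (quasiSplit F E c 3).Adelic) * y)‖ₑ)

/-- **THE POINTWISE BOUND.** For `T ≥ max(1, c₁)` and `Cb` the Mahler bound of level `T⁻¹` for the kernel of `|f|`: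
`Σ'_{q ∈ B(F)\G(F)} ‖ψ_T(q̃ y)‖ₑ ≤ ‖k^T_𝔬(y)‖ₑ + ‖f(z₁)‖ₑ + Cb` for every `y` (cases A and B; the Mahler condition in
case B is ★ `forall_inv_le_vecHeight_of_forall_borelHeight_le`). [cite: Rogawski1990, §7.3 (pp. 95–96)]
[cite: Rogawski1990, §2.2 (p. 13)] -/
theorem tsum_enorm_bracket_translate_le {cl : (quasiSplit F E c 3).arithmeticSubgroup → ι}
    (hc : c * c = 1) (hz₁ : (z₁ : (quasiSplit F E c 3).Adelic) =
      (quasiSplit F E c 3).toAdelic (ratCenter F E c 3 ((StdForm.antidiagonal 3).over E) ζ))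
    {i : ι} (hcl : ∀ γ : (quasiSplit F E c 3).arithmeticSubgroup, cl γ = i ↔
      ((adelicVal F E c 3 _ (γ : (quasiSplit F E c 3).Adelic) : GL (Fin 3) (AdeleRing (𝓞 E) E)) :
          Matrix (Fin 3) (Fin 3) (AdeleRing (𝓞 E) E)).charpoly =
        ((X - C ((ζ : Eˣ) : E)) ^ 3).map (algebraMap E (AdeleRing (𝓞 E) E)))
    (ν : Measure (adelicUnipotent F E c 3)) (𝓕 : Set (adelicUnipotent F E c 3)) {T : ℝ≥0} (hT : 1 ≤ T)
    {f : (quasiSplit F E c 3).Adelic → ℂ} (hf : HasCompactSupport f) {c₁ : ℝ≥0}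
    (hc₁ : ∀ g : (quasiSplit F E c 3).Adelic, c₁ < borelHeight g →
      ∀ γ : (quasiSplit F E c 3).arithmeticSubgroup, γ ∉ arithmeticBorel F E c 3 →
        f (g⁻¹ * (γ : (quasiSplit F E c 3).Adelic) * g) = 0)
    (hTc : c₁ ≤ T) {Cb : ℝ}
    (hCb : ∀ g : (quasiSplit F E c 3).Adelic,
      (∀ ξ : Fin 3 → E, ξ ≠ 0 →
        T⁻¹ ≤ vecHeight E (principalVec E ξ ᵥ* (adelicVal F E c 3 _ g : Matrix (Fin 3) (Fin 3) (AdeleRing (𝓞 E) E)))) →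
      ∑' γ : (quasiSplit F E c 3).arithmeticSubgroup, ‖f (g⁻¹ * (γ : (quasiSplit F E c 3).Adelic) * g)‖ ≤ Cb)
    (y : (quasiSplit F E c 3).Adelic) :
    ∑' q : Quotient (QuotientGroup.rightRel (arithmeticBorel F E c 3)),
        ‖((∑' u : {u : rationalUnipotent F E c 3 // u ≠ 1},
          f ((((q.out : (quasiSplit F E c 3).arithmeticSubgroup) : (quasiSplit F E c 3).Adelic) * y)⁻¹ * ((z₁ * ⟨(((u.1 : rationalUnipotent F E c 3) : adelicUnipotent F E c 3) : (quasiSplit F E c 3).Adelic), (u.1 : rationalUnipotent F E c 3).2⟩ : (quasiSplit F E c 3).arithmeticSubgroup) : (quasiSplit F E c 3).Adelic) * (((q.out : (quasiSplit F E c 3).arithmeticSubgroup) : (quasiSplit F E c 3).Adelic) * y))) -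
        kernelBorelTailClass ν 𝓕 T cl i f (((q.out : (quasiSplit F E c 3).arithmeticSubgroup) : (quasiSplit F E c 3).Adelic) * y))‖ₑ ≤
      ‖truncatedKernelClass ν 𝓕 T cl i f y‖ₑ + ‖f (z₁ : (quasiSplit F E c 3).Adelic)‖ₑ + ENNReal.ofReal Cb := by
  have hsum : Summable fun γ : cl ⁻¹' {i} =>
      f (y⁻¹ * (((γ : cl ⁻¹' {i}) : (quasiSplit F E c 3).arithmeticSubgroup) : (quasiSplit F E c 3).Adelic) * y) :=
    (summable_kernel_of_hasCompactSupport hf y y).subtype _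
  by_cases hex : ∃ γ₀ : (quasiSplit F E c 3).arithmeticSubgroup, T < borelHeight ((γ₀ : (quasiSplit F E c 3).Adelic) * y)
  · obtain ⟨γ₀, hγ₀⟩ := hex
    rw [tsum_enorm_bracket_translate_eq_of_lt ζ hc hz₁ hcl ν 𝓕 hT hc₁ hTc y hsum hγ₀]
    exact (enorm_sub_le).trans le_self_add
  · rw [not_exists] at hex
    have hle : ∀ γ : (quasiSplit F E c 3).arithmeticSubgroup,
        borelHeight ((γ : (quasiSplit F E c 3).Adelic) * y) ≤ T := fun γ => not_lt.1 (hex γ)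
    have hM := hCb y (forall_inv_le_vecHeight_of_forall_borelHeight_le hc hT hle)
    exact (tsum_enorm_bracket_translate_le_of_forall_le ζ hc hz₁ hcl ν 𝓕 T hf y hle hM).trans le_add_self

end Pointwise

/-! ## §3 (HINT): `∫⁻ β ‖ψ_T‖ₑ dν_G < ∞` -/

section Hint

variable [MeasurableSpace (adelicUnipotent F E c 3)] [BorelSpace (adelicUnipotent F E c 3)]
  [MeasurableSpace (quasiSplit F E c 3).Adelic] [BorelSpace (quasiSplit F E c 3).Adelic]

/-- **(HINT) THE UNFOLDED BRACKET IS ABSOLUTELY INTEGRABLE** — the binder `hint` of ★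
`truncatedTraceClass_central_eq_add_mul_integral`, token for token: for `f ∈ C_c(G(𝔸_F))`, a cut-off `T ≥ 1` above
the off-Borel vanishing height `c₁(f)` (★ `exists_forall_apply_conj_eq_zero_of_not_mem_arithmeticBorel`), an
automorphic measure `μ` for which `[g] ↦ k^T_𝔬(g⁻¹)` is integrable (★ LAW 3
`truncatedKernelClassIntegrable_cm` at the CM pin), an inversion-invariant Haar measure `ν_G` and a covering weight
`β` of `B(F)♯`:
`∫⁻_{G(𝔸)} β(g) ‖Σ'_{u ≠ 1} f(g⁻¹ z₁ u g) − 1_{T < H(g)} K_{B,𝔬}(g,g)‖ dν_G(g) < ∞`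
— unfold `‖ψ_T‖` back to `X` (★ `exists_ne_zero_lintegral_tsum_borelQuotient_eq_mul_lintegral`, left-`B(F)`-invariance
★ `bracket_rational_borel_mul`) and bound the coset sum pointwise by `‖k^T_𝔬‖ + ‖f(z₁)‖ + Cb` (§2).
[cite: Rogawski1990, §7.3 (pp. 95–96)] [cite: Arthur1978TraceFormulaI, §8] [cite: Gelbart1975, §9.B (9.40)–(9.46)] -/
theorem lintegral_weight_mul_enorm_bracket_lt_top {cl : (quasiSplit F E c 3).arithmeticSubgroup → ι}
    (hc : c * c = 1) (hc1 : c ≠ 1) (hz₁ : (z₁ : (quasiSplit F E c 3).Adelic) =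
      (quasiSplit F E c 3).toAdelic (ratCenter F E c 3 ((StdForm.antidiagonal 3).over E) ζ))
    {i : ι} (hcl : ∀ γ : (quasiSplit F E c 3).arithmeticSubgroup, cl γ = i ↔
      ((adelicVal F E c 3 _ (γ : (quasiSplit F E c 3).Adelic) : GL (Fin 3) (AdeleRing (𝓞 E) E)) :
          Matrix (Fin 3) (Fin 3) (AdeleRing (𝓞 E) E)).charpoly =
        ((X - C ((ζ : Eˣ) : E)) ^ 3).map (algebraMap E (AdeleRing (𝓞 E) E)))
    (hclN : IsUnipotentInvariantOnBorel F E c 3 cl)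
    (ν : Measure (adelicUnipotent F E c 3)) [ν.IsHaarMeasure]
    {𝓕 : Set (adelicUnipotent F E c 3)} (h𝓕 : IsFundamentalDomain (rationalUnipotent F E c 3) 𝓕 ν)
    {T : ℝ≥0} (hT : 1 ≤ T) {f : (quasiSplit F E c 3).Adelic → ℂ} (hfc : Continuous f) (hf : HasCompactSupport f)
    {c₁ : ℝ≥0}
    (hc₁ : ∀ g : (quasiSplit F E c 3).Adelic, c₁ < borelHeight g →
      ∀ γ : (quasiSplit F E c 3).arithmeticSubgroup, γ ∉ arithmeticBorel F E c 3 →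
        f (g⁻¹ * (γ : (quasiSplit F E c 3).Adelic) * g) = 0)
    (hTc : c₁ ≤ T)
    (μ : Measure (quasiSplit F E c 3).automorphicQuotient) [(quasiSplit F E c 3).IsAutomorphicMeasure μ]
    (νG : Measure (quasiSplit F E c 3).Adelic) [νG.IsHaarMeasure] [νG.IsInvInvariant]
    {β : (quasiSplit F E c 3).Adelic → ℝ≥0∞}
    (hβ : IsCoveringWeight ((arithmeticBorel F E c 3).map (quasiSplit F E c 3).arithmeticSubgroup.subtype) β)
    (hkint : Integrable ((quasiSplit F E c 3).quotFun (truncatedKernelClass ν 𝓕 T cl i f)) μ) :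
    ∫⁻ g, β g * ‖(∑' u : {u : rationalUnipotent F E c 3 // u ≠ 1},
        f (g⁻¹ * ((z₁ * ⟨(((u.1 : rationalUnipotent F E c 3) : adelicUnipotent F E c 3) : (quasiSplit F E c 3).Adelic), (u.1 : rationalUnipotent F E c 3).2⟩ :
            (quasiSplit F E c 3).arithmeticSubgroup) : (quasiSplit F E c 3).Adelic) * g)) -
      kernelBorelTailClass ν 𝓕 T cl i f g‖ₑ ∂νG < ∞ := by
  classical
  have hT0 : 0 < T := lt_of_lt_of_le one_pos hT
  -- the Mahler bound of level `T⁻¹` for the kernel of `|f|`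
  have hFc : Continuous fun g : (quasiSplit F E c 3).Adelic => (((‖f g‖ : ℝ)) : ℂ) :=
    Complex.continuous_ofReal.comp hfc.norm
  have hFs : HasCompactSupport fun g : (quasiSplit F E c 3).Adelic => (((‖f g‖ : ℝ)) : ℂ) :=
    hf.norm.comp_left Complex.ofReal_zero
  obtain ⟨Cb, hCb⟩ := exists_forall_norm_kernel_le (F := F) (E := E) (c := c) (N := 3) (inv_pos.2 hT0) hFc hFs
  have hCb' : ∀ g : (quasiSplit F E c 3).Adelic,
      (∀ ξ : Fin 3 → E, ξ ≠ 0 →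
        T⁻¹ ≤ vecHeight E (principalVec E ξ ᵥ* (adelicVal F E c 3 _ g : Matrix (Fin 3) (Fin 3) (AdeleRing (𝓞 E) E)))) →
      ∑' γ : (quasiSplit F E c 3).arithmeticSubgroup, ‖f (g⁻¹ * (γ : (quasiSplit F E c 3).Adelic) * g)‖ ≤ Cb := by
    intro g hg
    rw [← norm_kernel_ofReal_norm hf g g]
    exact hCb g hg
  -- the bracket as a `[0,∞]`-valued, Borel, left-`B(F)`-invariant function
  haveI := t2Space_quasiSplitAdelic (F := F) (E := E) (c := c) (N := 3)
  haveI := locallyCompactSpace_quasiSplitAdelic (F := F) (E := E) (c := c) (N := 3)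
  haveI := secondCountableTopology_quasiSplitAdelic (F := F) (E := E) (c := c) (N := 3)
  -- `N(𝔸_F)` closed: second countable, locally compact, `ν` s-finite (as in ★ B1)
  haveI := t2Space_adeleRing_of_numberField E
  have hNcl : IsClosed ((adelicUnipotent F E c 3 : Set (quasiSplit F E c 3).Adelic)) := by
    change IsClosed (⇑(adelicVal F E c 3 ((StdForm.antidiagonal 3).over E)) ⁻¹'
      ((upperUnitriangular (Fin 3) (AdeleRing (𝓞 E) E) : Subgroup (GL (Fin 3) (AdeleRing (𝓞 E) E))) :
        Set (GL (Fin 3) (AdeleRing (𝓞 E) E))))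
    exact (isClosed_upperUnitriangular (R := AdeleRing (𝓞 E) E)).preimage continuous_subtype_val
  haveI : SecondCountableTopology (adelicUnipotent F E c 3) := TopologicalSpace.Subtype.secondCountableTopology _
  haveI : LocallyCompactSpace (adelicUnipotent F E c 3) := hNcl.locallyCompactSpace
  haveI : SFinite ν := inferInstance
  set Θ : (quasiSplit F E c 3).Adelic → ℝ≥0∞ := fun g => ‖(∑' u : {u : rationalUnipotent F E c 3 // u ≠ 1},
        f (g⁻¹ * ((z₁ * ⟨(((u.1 : rationalUnipotent F E c 3) : adelicUnipotent F E c 3) : (quasiSplit F E c 3).Adelic), (u.1 : rationalUnipotent F E c 3).2⟩ :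
            (quasiSplit F E c 3).arithmeticSubgroup) : (quasiSplit F E c 3).Adelic) * g)) -
      kernelBorelTailClass ν 𝓕 T cl i f g‖ₑ with hΘ
  have hΘm : Measurable Θ := (measurable_bracket (z₁ := z₁) ν 𝓕 T hfc i).enorm
  have hΘinv : ∀ b ∈ arithmeticBorel F E c 3, ∀ y : (quasiSplit F E c 3).Adelic,
      Θ ((b : (quasiSplit F E c 3).Adelic) * y) = Θ y := by
    intro b hb y
    simp only [hΘ]
    rw [bracket_rational_borel_mul ζ hc hc1 hz₁ hclN ν h𝓕 T hfc hf i b hb y]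
  -- unfold to `X`
  obtain ⟨C, hC0, hCtop, hunf⟩ := exists_ne_zero_lintegral_tsum_borelQuotient_eq_mul_lintegral μ νG
  have hX := hunf β hβ Θ hΘm hΘinv
  -- pointwise bound on `X`
  have hpt : ∀ x : (quasiSplit F E c 3).automorphicQuotient,
      (∑' q : Quotient (QuotientGroup.rightRel (arithmeticBorel F E c 3)),
        Θ ((((q.out : (quasiSplit F E c 3).arithmeticSubgroup) : (quasiSplit F E c 3).Adelic)) *
          (Quotient.out x : (quasiSplit F E c 3).Adelic)⁻¹)) ≤
        ‖(quasiSplit F E c 3).quotFun (truncatedKernelClass ν 𝓕 T cl i f) x‖ₑ +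
          ‖f (z₁ : (quasiSplit F E c 3).Adelic)‖ₑ + ENNReal.ofReal Cb := by
    intro x
    exact tsum_enorm_bracket_translate_le ζ hc hz₁ hcl ν 𝓕 hT hf hc₁ hTc hCb'
      ((Quotient.out x : (quasiSplit F E c 3).Adelic)⁻¹)
  -- integrate the bound
  have hfinX : ∫⁻ x, (∑' q : Quotient (QuotientGroup.rightRel (arithmeticBorel F E c 3)),
        Θ ((((q.out : (quasiSplit F E c 3).arithmeticSubgroup) : (quasiSplit F E c 3).Adelic)) *
          (Quotient.out x : (quasiSplit F E c 3).Adelic)⁻¹)) ∂μ < ∞ := by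
    refine lt_of_le_of_lt (lintegral_mono hpt) ?_
    rw [lintegral_add_right _ measurable_const, lintegral_const]
    refine ENNReal.add_lt_top.2 ⟨?_, ?_⟩
    · rw [lintegral_add_right _ measurable_const, lintegral_const]
      refine ENNReal.add_lt_top.2 ⟨hkint.2, ENNReal.mul_lt_top enorm_lt_top (measure_lt_top μ _)⟩
    · exact ENNReal.mul_lt_top ENNReal.ofReal_lt_top (measure_lt_top μ _)
  rw [hX] at hfinX
  by_contra hI
  rw [not_lt, top_le_iff] at hI
  rw [hI, ENNReal.mul_top hC0] at hfinX
  exact lt_irrefl _ hfinX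

/-- **(HINT), threshold form.** There is `T₀` (depending on `f` only) such that for every `T > T₀` the unfolded
bracket is absolutely integrable whenever `[g] ↦ k^T_𝔬(g⁻¹)` is `μ`-integrable (★ LAW 3 at the CM pin).
[cite: Rogawski1990, §7.3 (pp. 95–96)] [cite: Arthur1978TraceFormulaI, §8] -/
theorem exists_forall_lintegral_weight_mul_enorm_bracket_lt_top {cl : (quasiSplit F E c 3).arithmeticSubgroup → ι}
    (hc : c * c = 1) (hc1 : c ≠ 1) (hz₁ : (z₁ : (quasiSplit F E c 3).Adelic) =
      (quasiSplit F E c 3).toAdelic (ratCenter F E c 3 ((StdForm.antidiagonal 3).over E) ζ))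
    {i : ι} (hcl : ∀ γ : (quasiSplit F E c 3).arithmeticSubgroup, cl γ = i ↔
      ((adelicVal F E c 3 _ (γ : (quasiSplit F E c 3).Adelic) : GL (Fin 3) (AdeleRing (𝓞 E) E)) :
          Matrix (Fin 3) (Fin 3) (AdeleRing (𝓞 E) E)).charpoly =
        ((X - C ((ζ : Eˣ) : E)) ^ 3).map (algebraMap E (AdeleRing (𝓞 E) E)))
    (hclN : IsUnipotentInvariantOnBorel F E c 3 cl)
    (ν : Measure (adelicUnipotent F E c 3)) [ν.IsHaarMeasure]
    {𝓕 : Set (adelicUnipotent F E c 3)} (h𝓕 : IsFundamentalDomain (rationalUnipotent F E c 3) 𝓕 ν)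
    {f : (quasiSplit F E c 3).Adelic → ℂ} (hfc : Continuous f) (hf : HasCompactSupport f)
    (μ : Measure (quasiSplit F E c 3).automorphicQuotient) [(quasiSplit F E c 3).IsAutomorphicMeasure μ]
    (νG : Measure (quasiSplit F E c 3).Adelic) [νG.IsHaarMeasure] [νG.IsInvInvariant]
    {β : (quasiSplit F E c 3).Adelic → ℝ≥0∞}
    (hβ : IsCoveringWeight ((arithmeticBorel F E c 3).map (quasiSplit F E c 3).arithmeticSubgroup.subtype) β) :
    ∃ T₀ : ℝ≥0, ∀ T : ℝ≥0, T₀ < T →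
      Integrable ((quasiSplit F E c 3).quotFun (truncatedKernelClass ν 𝓕 T cl i f)) μ →
      ∫⁻ g, β g * ‖(∑' u : {u : rationalUnipotent F E c 3 // u ≠ 1},
        f (g⁻¹ * ((z₁ * ⟨(((u.1 : rationalUnipotent F E c 3) : adelicUnipotent F E c 3) : (quasiSplit F E c 3).Adelic), (u.1 : rationalUnipotent F E c 3).2⟩ :
            (quasiSplit F E c 3).arithmeticSubgroup) : (quasiSplit F E c 3).Adelic) * g)) -
      kernelBorelTailClass ν 𝓕 T cl i f g‖ₑ ∂νG < ∞ := by
  obtain ⟨c₁, hc₁⟩ := exists_forall_apply_conj_eq_zero_of_not_mem_arithmeticBorel (F := F) (E := E) (c := c) hf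
  refine ⟨max 1 c₁, fun T hT hkint => ?_⟩
  exact lintegral_weight_mul_enorm_bracket_lt_top ζ hc hc1 hz₁ hcl hclN ν h𝓕 (le_of_lt (lt_of_le_of_lt (le_max_left _ _) hT))
    hfc hf hc₁ (le_of_lt (lt_of_le_of_lt (le_max_right _ _) hT)) μ νG hβ hkint

end Hint

end UnitaryGroup

end Literature.NumberTheory.Automorphic
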